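import Summits.ABC.IUTFork.ForkGenuineMinLaw
import Literature.IUT.LogVolume.CompletionLocalFieldsUnramified
import HarnessLib

/-!
# The fork at [IUTchIII] Corollary 3.12 at a GENUINE input: the E-MIN law IN PILOT-DATA TERMS — the typed Θ-side summand at an
# unramified odd prime as a closed function of `(ord_v(q_v), e_v, Pr(v))_{v | p}` (skeleton XXVIIf-b)

Record-only file (D-0012) of the abc-iut cell (deliverable (a), skeleton seat abc-iut-skel, gen 9); TAKES NO SIDE.
Sequel to `ForkGenuineMinLaw.lean` (XXVIIf, p447487: `negLogThetaLoc I p = (1/ℓ⋇)·Σ_i Σ_{v⃗} (−min_b n_i(v_b)·log p)·Π Pr(v_b)` at an odd prime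
with all `σ`-completions absolutely unramified, exponents `n_i(v)` of the idele norms). HERE the exponents are ELIMINATED in favour of the
pilot data (`e_v·n_i(v) = P_{Θ,i}(v)`, `P_{Θ,i} = (i+1)²·P_q`, `P_q(v) = ord_v(q_v)/(2l)` on `S`, `0` off `S`), so that the summand is a closed
function of the input's printed data — the form a table of genuine data (the cell's R-W / R-H window tables, `type(v) = unram-odd` column)
consumes without numerics:

* **`negLogThetaLoc_eq_min_thetaPilot_of_unramified`** — `negLogThetaLoc I p = (1/ℓ⋇)·Σ_i Σ_{v⃗ ∈ 𝕍_p^{i+2}}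
  (−min_b (P_{Θ,i}(v_b)/e_{v_b})·log p)·Π_b Pr(v_b)` (`he`: all `K_{v̲}`, `v | p`, absolutely unramified, `p > 2`; at such places `e_v = 1`,
  kept symbolic); `…_of_not_dvd_discr` — the same under `p ∤ disc K` (abc-iut-S7's `absRamificationIdx_localFieldFamily_eq_one`);
* `negAbsLogQAt_tΘ_eq_thetaPilot` — the BARE value `ln ν̄(O_𝕃(−P_Θ)_p) = (1/ℓ⋇)·Σ_i Σ_{v⃗} (−(P_{Θ,i}(v_last)/e_{v_last})·log p)·Π Pr` (any prime);
* **`negLogThetaLoc_eq_bare_iff_qPilot`** — at such a prime the typed summand equals the bare value IFF `P_q(v)/e_v` is CONSTANT on the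
  places over `p` (all `v | p` bad with the same `ord_v(q_v)/(2l·e_v)`, or none bad): XXVIIf's slot-constancy read on the `q`-pilot;
* `negLogThetaLoc_gt_bare_of_mem_of_not_mem` — a bad and a good place over the same unramified odd prime ⇒ STRICT (Ind1) inflation.

READING (grammar of `HOME/skel/FORK-REAL-MODEL.md` §12–§13; no side taken): at an unramified odd prime the typed `−|log(Θ)|_p` is a closed
function of the printed pilot data; inflation there = (Ind1) mixing, present exactly when the places over `p` carry different `q`-depths per
unit ramification. HONEST SCOPE: statements about OUR typed numbers for every inhabitant of abc-iut-S2's input type (genuine `T.I` included);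
which primes of a given collection of initial Θ-data are of this type is data, not decided here; sharp (Ind3), full (Ind1)/(Ind2), Mochizuki's
container. Nothing here bears on whether [IUTchIII] Thm. 3.11 licenses Cor. 3.12; typed ≠ proved. PROOF-ONLY file: no definitions, no `Prop` facts.
[cite: Mochizuki2012, IUTchIV Prop. 1.2 (iv) p. 11, Thm. 1.10 Step (v)–(vi) p. 27–29] [cite: DupuyHilado2025, §2.4.2, §3.3, §3.4, §3.9,
Thm. 3.10.1, §4.7, §4.11–4.12] [cite: Mochizuki2012, IUTchIII Cor. 3.12 p. 173–174] [claim: Mochizuki2012, status: disputed]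
-/

noncomputable section

open Set Module Literature.IUT.LogVolume Literature.NumberTheory.NumberFields NumberField IsDedekindDomain
open scoped Pointwise

namespace Summit.ABC.IUTFork.GenuineContent

section Pilot

variable {F₀ : Type} [Field F₀] [NumberField F₀] {K : Type} [Field K] [NumberField K] [Algebra F₀ K]
variable (I : ThetaVolumeInput F₀ K) (p : ℕ) [hp : Fact p.Prime]

omit hp in
/-- The exponents of XXVIIf in pilot terms: `n_i(v) = P_{Θ,i}(v)/e_v` as real numbers. [cite: DupuyHilado2025, §2.4.2, §3.4] -/
theorem cast_eq_thetaPilot_div_ramIdx {n : ℤ} {i : Fin I.lstar} {v : placesOver F₀ p}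
    (h : (ramIdx F₀ v.1 : ℝ) * n = I.X.thetaPilot i v.1) : (n : ℝ) = I.X.thetaPilot i v.1 / ramIdx F₀ v.1 := by
  have he0 : (ramIdx F₀ v.1 : ℝ) ≠ 0 := by exact_mod_cast ramIdx_ne_zero F₀ v.1
  rw [← h]
  field_simp

omit hp in
/-- The minimum over a tuple commutes with the cast `ℤ → ℝ` and the identification `n_i(v) = P_{Θ,i}(v)/e_v`.
[cite: DupuyHilado2025, §3.4, §4.7] -/
theorem cast_inf'_eq_inf'_thetaPilot (n : Fin I.lstar → placesOver F₀ p → ℤ)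
    (hn : ∀ (i : Fin I.lstar) (v : placesOver F₀ p), (ramIdx F₀ v.1 : ℝ) * n i v = I.X.thetaPilot i v.1)
    (i : Fin I.lstar) {m : ℕ} (e : Fin (m + 1) → placesOver F₀ p) :
    (((Finset.univ.inf' Finset.univ_nonempty fun b => n i (e b) : ℤ) : ℝ)) =
      Finset.univ.inf' Finset.univ_nonempty fun b => I.X.thetaPilot i (e b).1 / ramIdx F₀ (e b).1 := by
  rw [Finset.apply_inf'_eq_inf'_comp Finset.univ_nonempty (fun x : ℤ => (x : ℝ)) fun x y => Int.cast_min]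
  exact congrArg (Finset.univ.inf' Finset.univ_nonempty)
    (funext fun b => cast_eq_thetaPilot_div_ramIdx I p (hn i (e b)))

/-- **THE E-MIN LAW IN PILOT TERMS**: for every input `I` and every ODD prime `p` at which all `σ`-completions `K_{v̲}` (`v | p`) are absolutely
unramified, `negLogThetaLoc I p = (1/ℓ⋇)·Σ_i Σ_{v⃗ ∈ 𝕍_p^{i+2}} (−min_b (P_{Θ,i}(v_b)/e_{v_b})·log p)·Π_b Pr(v_b)` — a closed function of the pilot
divisor, the ramification indices and the weights (at such places `e_v = 1`). HYPOTHESIS-free evaluation of OUR typed number; no side taken.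
[cite: Mochizuki2012, IUTchIV Prop. 1.2 (iv) p. 11, Thm. 1.10 Step (vi) p. 29] [cite: DupuyHilado2025, Def. 3.6.3, §4.7, §4.11–4.12]
[claim: Mochizuki2012, status: disputed] -/
theorem negLogThetaLoc_eq_min_thetaPilot_of_unramified (hp2 : 2 < p)
    (he : ∀ v : placesOver F₀ p, absRamificationIdx p ((I.σ.localFieldFamily p hp.out).k v) = 1) :
    I.negLogThetaLoc p =
      (1 / (I.lstar : ℝ)) * ∑ i : Fin I.lstar, ∑ e : Fin ((i : ℕ) + 1 + 1) → placesOver F₀ p,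
        -((Finset.univ.inf' Finset.univ_nonempty fun b => I.X.thetaPilot i (e b).1 / ramIdx F₀ (e b).1) * Real.log p) *
          ∏ b, weight F₀ (e b).1 := by
  obtain ⟨n, hn⟩ := exists_int_norms_tΘ_of_unramified I p he
  rw [negLogThetaLoc_eq_min_of_unramified I p hp2 he n fun i v => (hn i v).1]
  refine congrArg (fun x : ℝ => (1 / (I.lstar : ℝ)) * x)
    (Finset.sum_congr rfl fun i _ => Finset.sum_congr rfl fun e _ => ?_)
  rw [cast_inf'_eq_inf'_thetaPilot I p n (fun i v => (hn i v).2) i e]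

/-- **The same under `p ∤ disc K`** (then every `K_{v̲}`, `v | p`, is absolutely unramified: abc-iut-S7's
`PlaceSection.absRamificationIdx_localFieldFamily_eq_one`). [cite: NeukirchANT1999, Ch. III Cor. (2.12)]
[cite: Mochizuki2012, IUTchIV Thm. 1.10 Step (vi) p. 29] [claim: Mochizuki2012, status: disputed] -/
theorem negLogThetaLoc_eq_min_thetaPilot_of_not_dvd_discr (hp2 : 2 < p) (hdisc : ¬ (p : ℤ) ∣ NumberField.discr K) :
    I.negLogThetaLoc p =
      (1 / (I.lstar : ℝ)) * ∑ i : Fin I.lstar, ∑ e : Fin ((i : ℕ) + 1 + 1) → placesOver F₀ p,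
        -((Finset.univ.inf' Finset.univ_nonempty fun b => I.X.thetaPilot i (e b).1 / ramIdx F₀ (e b).1) * Real.log p) *
          ∏ b, weight F₀ (e b).1 :=
  negLogThetaLoc_eq_min_thetaPilot_of_unramified I p hp2 fun v => I.σ.absRamificationIdx_localFieldFamily_eq_one hdisc v

/-- **The BARE value in pilot terms** (any prime at which the completions are absolutely unramified, so that the idele norms are integral powers of `p`):
`ln ν̄(O_𝕃(−P_Θ)_p) = (1/ℓ⋇)·Σ_i Σ_{v⃗} (−(P_{Θ,i}(v_last)/e_{v_last})·log p)·Π Pr(v_b)`. [cite: DupuyHilado2025, §3.9, Thm. 3.10.1] -/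
theorem negAbsLogQAt_tΘ_eq_thetaPilot
    (he : ∀ v : placesOver F₀ p, absRamificationIdx p ((I.σ.localFieldFamily p hp.out).k v) = 1) :
    (I.packetAt p hp.out).negAbsLogQAt I.lstar (I.tΘ p hp.out) =
      (1 / (I.lstar : ℝ)) * ∑ i : Fin I.lstar, ∑ e : Fin ((i : ℕ) + 1 + 1) → placesOver F₀ p,
        -((I.X.thetaPilot i (e (Fin.last ((i : ℕ) + 1))).1 / ramIdx F₀ (e (Fin.last ((i : ℕ) + 1))).1) * Real.log p) *
          ∏ b, weight F₀ (e b).1 := by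
  obtain ⟨n, hn⟩ := exists_int_norms_tΘ_of_unramified I p he
  have h := realPrimePacketWith_negAbsLogQAt_eq_of_norm p (I.σ.localFieldFamily p hp.out)
    (mScale p (I.σ.localFieldFamily p hp.out)) (mScale_ne_zero p (I.σ.localFieldFamily p hp.out))
    (mScale_perm p (I.σ.localFieldFamily p hp.out)) (I.tΘ p hp.out) n fun i v => (hn i v).1
  refine h.trans (congrArg (fun x : ℝ => (1 / (I.lstar : ℝ)) * x)
    (Finset.sum_congr rfl fun i _ => Finset.sum_congr rfl fun e _ => ?_))
  rw [cast_eq_thetaPilot_div_ramIdx I p (hn i (e (Fin.last ((i : ℕ) + 1)))).2]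

/-- `P_{Θ,i}(v) = (i+1)²·P_q(v)`. [cite: DupuyHilado2025, §3.3] -/
theorem thetaPilot_apply_eq_sq_mul (i : Fin I.lstar) (v : HeightOneSpectrum (𝓞 F₀)) :
    I.X.thetaPilot i v = (((i : ℕ) : ℝ) + 1) ^ 2 * I.X.qPilot v := by
  rw [PilotData.thetaPilot_eq_smul, Finsupp.smul_apply, smul_eq_mul]

/-- **NO INFLATION IFF THE `q`-PILOT PER UNIT RAMIFICATION IS CONSTANT OVER `p`**: at an odd prime with all `σ`-completions absolutely unramified,
`negLogThetaLoc I p = ln ν̄(O_𝕃(−P_Θ)_p)` (the bare value) iff `P_q(v)/e_v` takes ONE value on the places over `p` — i.e. either no place over `p`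
is bad, or all are bad with the same `ord_v(q_v)/(2l·e_v)`. (XXVIIf's `…_iff_slotConstant` with `n_i(v) = (i+1)²·P_q(v)/e_v`.)
[cite: Mochizuki2012, IUTchIV Thm. 1.10 Step (v)–(vi) p. 27–29] [cite: DupuyHilado2025, §3.3, §4.7] [claim: Mochizuki2012, status: disputed] -/
theorem negLogThetaLoc_eq_bare_iff_qPilot (hp2 : 2 < p)
    (he : ∀ v : placesOver F₀ p, absRamificationIdx p ((I.σ.localFieldFamily p hp.out).k v) = 1) :
    I.negLogThetaLoc p = (I.packetAt p hp.out).negAbsLogQAt I.lstar (I.tΘ p hp.out) ↔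
      ∀ v w : placesOver F₀ p, I.X.qPilot v.1 / ramIdx F₀ v.1 = I.X.qPilot w.1 / ramIdx F₀ w.1 := by
  obtain ⟨n, hn⟩ := exists_int_norms_tΘ_of_unramified I p he
  rw [I.negLogThetaLoc_of_prime hp.out]
  have key := negLogThetaAt_eq_negAbsLogQAt_iff_slotConstant p (I.σ.localFieldFamily p hp.out)
    (mScale p (I.σ.localFieldFamily p hp.out)) (mScale_ne_zero p (I.σ.localFieldFamily p hp.out))
    (mScale_perm p (I.σ.localFieldFamily p hp.out)) hp2 he (I.tΘ p hp.out) n fun i v => (hn i v).1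
  refine key.trans ⟨fun h v w => ?_, fun h i v w => ?_⟩
  · have hl : 0 < I.lstar := by have := I.X.two_le_lstar; unfold ThetaVolumeInput.lstar; omega
    have hi := h ⟨0, hl⟩ v w
    have hv := cast_eq_thetaPilot_div_ramIdx I p (hn ⟨0, hl⟩ v).2
    have hw := cast_eq_thetaPilot_div_ramIdx I p (hn ⟨0, hl⟩ w).2
    rw [thetaPilot_apply_eq_sq_mul] at hv hw
    have hcast : ((n ⟨0, hl⟩ v : ℤ) : ℝ) = n ⟨0, hl⟩ w := by exact_mod_cast hi
    rw [hv, hw] at hcast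
    simpa using hcast
  · have hv := cast_eq_thetaPilot_div_ramIdx I p (hn i v).2
    have hw := cast_eq_thetaPilot_div_ramIdx I p (hn i w).2
    rw [thetaPilot_apply_eq_sq_mul, mul_div_assoc, h v w, ← mul_div_assoc, ← thetaPilot_apply_eq_sq_mul] at hv
    exact_mod_cast hv.trans hw.symm

/-- **A bad and a good place over the same unramified odd prime force STRICT (Ind1) inflation** of the typed summand over the bare value
(`P_q(v) > 0 = P_q(w)`). [cite: Mochizuki2012, IUTchIV Thm. 1.10 Step (v)–(vi) p. 27–29] [claim: Mochizuki2012, status: disputed] -/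
theorem negLogThetaLoc_gt_bare_of_mem_of_not_mem (hp2 : 2 < p)
    (he : ∀ v : placesOver F₀ p, absRamificationIdx p ((I.σ.localFieldFamily p hp.out).k v) = 1)
    {v w : placesOver F₀ p} (hv : v.1 ∈ I.X.S) (hw : w.1 ∉ I.X.S) :
    (I.packetAt p hp.out).negAbsLogQAt I.lstar (I.tΘ p hp.out) < I.negLogThetaLoc p := by
  obtain ⟨n, hn⟩ := exists_int_norms_tΘ_of_unramified I p he
  have hle : (I.packetAt p hp.out).negAbsLogQAt I.lstar (I.tΘ p hp.out) ≤ I.negLogThetaLoc p := by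
    rw [I.negLogThetaLoc_of_prime hp.out]
    exact negAbsLogQAt_le_negLogThetaAt_of_unramified p (I.σ.localFieldFamily p hp.out)
      (mScale p (I.σ.localFieldFamily p hp.out)) (mScale_ne_zero p (I.σ.localFieldFamily p hp.out))
      (mScale_perm p (I.σ.localFieldFamily p hp.out)) hp2 he (I.tΘ p hp.out) n fun i v => (hn i v).1
  refine lt_of_le_of_ne hle fun heq => ?_
  have hconst := (negLogThetaLoc_eq_bare_iff_qPilot I p hp2 he).mp heq.symm v w
  rw [PilotData.qPilot_apply_of_not_mem I.X hw, zero_div, div_eq_zero_iff] at hconst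
  rcases hconst with h0 | h0
  · rw [PilotData.qPilot_apply_of_mem I.X hv] at h0
    have hpos : (0 : ℝ) < (I.X.ordq v.1 : ℝ) / (2 * I.X.l) :=
      div_pos (by exact_mod_cast I.X.ordq_pos hv) (by have := I.X.five_le_l; positivity)
    exact hpos.ne' h0
  · exact (ramIdx_ne_zero F₀ v.1) (by exact_mod_cast h0)

end Pilot

end Summit.ABC.IUTFork.GenuineContent

end
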